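import Summits.CriticalPhenomena.PercolationContinuityZ3.Theorems.Transplant.PlanarSkeletonFrmFromDefs
import Summits.CriticalPhenomena.PercolationContinuityZ3.Theorems.Transplant.SkelFrmFromBParamsSlotsST
import Summits.CriticalPhenomena.PercolationContinuityZ3.Theorems.Transplant.SkelFrmBParamsSlotsST
import Summits.CriticalPhenomena.PercolationContinuityZ3.Theorems.Transplant.SkelFrmFromBChoiceRadii
import Summits.CriticalPhenomena.PercolationContinuityZ3.Theorems.Transplant.SkelFrmBChoiceRadii
import HarnessLib
import Summits.CriticalPhenomena.PercolationContinuityZ3.Theorems.Transplant.SkelFrmBChoiceRadiiT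
/-!
# U-WAVE PORT (RULING D-U, lead g21 2026-08-26; WAVE-U-MANIFEST v3.0 row «SkelFrmBChoiceRadiiT» ↦ «SkelFrmFromBChoiceRadiiT») of the tree module
# `Transplant/SkelFrmBChoiceRadiiT` onto the carrier `PlanarSkeletonFrmFrom` (frames only, cylinders connected from width `ℓ₀` on)

ORIGINAL TITLE: (R-40) `…T` TWIN (stmt-g21, 2026-08-23; ruling p3-g16 06:23:56Z, J18; lead g11 06:35:07Z: the choice function of record moves to `frmChoiceAllQ3T`): the twin of

builds on p205010 (kernel theorem, internal audit signed; external expert review pending) — nothing in this file uses p205010; NOTHING is claimed about the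
OPEN node U `SamePDropOfSkeletonFrmFrom₁` (nor U_s / the end state).  Lane `prim-bschramm`, seat `prim-hp-8 gen 53 (U-wave port pen, family P-hp8; tool of record = p3-g26 port_u.py)`; helper file
(`--supports stmt-CriticalPhenomena-4575 --as helper`).  PORT RULES r1–r4 of RULING D-U: declaration order and proof texts are those of the original,
byte-identical except (i) the carrier token `PlanarSkeletonFrm ↦ PlanarSkeletonFrmFrom` (binders, `namespace`/`end` lines, qualified names of twinned
declarations), (ii) carrier-FREE declarations of the original (φ-level `Skelφ…` blocks and namespace-only arithmetic residents) are NOT re-declared —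
this file imports the original and `export`s the twin-free residents (POLICY T / treatment (m1)); residents whose statement mentions a twinned
constant are copied, (iii) every carrier-binding declaration keeps its explicit binder `(Φ : PlanarSkeletonFrmFrom G)` in its own signature (r2).  Docstrings and citations are the original's.  Manifest row idx 82 (level 12; flags verbatim|IDLE-FOR-NODE); filed by the hp-8 lineage under RULING M-11 (family P-hp8).
-/

noncomputable section

open scoped Classical

namespace Summit.CriticalPhenomena.PercolationContinuityZ3.Theorems.Transplant

namespace PlanarSkeletonFrmFrom

namespace NegB

open Literature.Probability.Percolation Literature.Probability.LatticeModels SimpleGraph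
open SkelConc (Consts)
open BoxProdZ2 (ConcRadiiG Erad Frad nQ)
open Neg

/-! ## §1 Every radius of the schedule of record dominates `E₀` (any block) -/

section AnyBlock

variable (κ : Consts) {V : Type} [DecidableEq V] [Countable V] {G : SimpleGraph V} [G.LocallyFinite] (Φ : PlanarSkeletonFrmFrom G) (t : V)
  (p : unitInterval) (D : Skelφ.StepI.DataNS V) (g f : ℕ) (c : Fin 2 → ℕ) (S : Skelφ.Prm.SchedIn)

/-- `E (nQ a x) ≤ rQ a x`. [folklore] -/
theorem Erad_le_rQ_T (κ : Consts) {V : Type} [DecidableEq V] [Countable V] {G : SimpleGraph V} [G.LocallyFinite] (Φ : PlanarSkeletonFrmFrom G) (t : V) (p : unitInterval) (D : Skelφ.StepI.DataNS V) (g : ℕ) (f : ℕ) (c : Fin 2 → ℕ) (S : Skelφ.Prm.SchedIn) (a : ℕ) (x : Site 2) :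
    Erad (Skelφ.Prm.gap S) (fun _ => 0) (Skelφ.Prm.E₀ S) (nQ a x) ≤ (schedOfT κ Φ t p D g f c S).rQ a x :=
  Skelφ.Erad_le_rQN _ _ _ _ _ _ a x

/-- **`E₀ ≤ rQ a x`**. [folklore] -/
theorem E₀_le_rQ_T (κ : Consts) {V : Type} [DecidableEq V] [Countable V] {G : SimpleGraph V} [G.LocallyFinite] (Φ : PlanarSkeletonFrmFrom G) (t : V) (p : unitInterval) (D : Skelφ.StepI.DataNS V) (g : ℕ) (f : ℕ) (c : Fin 2 → ℕ) (S : Skelφ.Prm.SchedIn) (a : ℕ) (x : Site 2) : Skelφ.Prm.E₀ S ≤ (schedOfT κ Φ t p D g f c S).rQ a x :=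
  le_trans (Skel.E₀_le_Erad _ _ _ _) (Erad_le_rQ_T κ Φ t p D g f c S a x)

/-- **`E₀ ≤ rB a v δ`** (`rB = E (nQ a (v+δ))`). [folklore] -/
theorem E₀_le_rB_T (κ : Consts) {V : Type} [DecidableEq V] [Countable V] {G : SimpleGraph V} [G.LocallyFinite] (Φ : PlanarSkeletonFrmFrom G) (t : V) (p : unitInterval) (D : Skelφ.StepI.DataNS V) (g : ℕ) (f : ℕ) (c : Fin 2 → ℕ) (S : Skelφ.Prm.SchedIn) (a : ℕ) (v : Site 2) (δ : MDir) : Skelφ.Prm.E₀ S ≤ (schedOfT κ Φ t p D g f c S).rB a v δ := by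
  show _ ≤ Erad (Skelφ.Prm.gap S) (fun _ => 0) (Skelφ.Prm.E₀ S) (nQ a (v + stepVec δ))
  exact Skel.E₀_le_Erad _ _ _ _

/-- **`E₀ ≤ rM a x + L′`** (`rM = F (nQ a x) − L′`, `F ≥ E₀`). [folklore] -/
theorem E₀_le_rM_T (κ : Consts) {V : Type} [DecidableEq V] [Countable V] {G : SimpleGraph V} [G.LocallyFinite] (Φ : PlanarSkeletonFrmFrom G) (t : V) (p : unitInterval) (D : Skelφ.StepI.DataNS V) (g : ℕ) (f : ℕ) (c : Fin 2 → ℕ) (S : Skelφ.Prm.SchedIn) (a : ℕ) (x : Site 2) : Skelφ.Prm.E₀ S ≤ (schedOfT κ Φ t p D g f c S).rM a x + Skelφ.Prm.Lp S := by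
  show _ ≤ Frad (Skelφ.Prm.gap S) (fun _ => 0) (Skelφ.Prm.E₀ S) (nQ a x) - Skelφ.Prm.Lp S + Skelφ.Prm.Lp S
  have := Skel.E₀_le_Frad (Skelφ.Prm.gap S) (fun _ => 0) (Skelφ.Prm.E₀ S) (nQ a x)
  omega

/-- **Linear growth of the cube radius**: `E₀ + c′·k ≤ rQ a x` for every `k ≤ nQ a x` and every `c′ ≤ gap`. [folklore] -/
theorem lin_le_rQ_T (κ : Consts) {V : Type} [DecidableEq V] [Countable V] {G : SimpleGraph V} [G.LocallyFinite] (Φ : PlanarSkeletonFrmFrom G) (t : V) (p : unitInterval) (D : Skelφ.StepI.DataNS V) (g : ℕ) (f : ℕ) (c : Fin 2 → ℕ) (S : Skelφ.Prm.SchedIn) {c' : ℕ} (hgap : ∀ n, c' ≤ Skelφ.Prm.gap S n) (a : ℕ) (x : Site 2) {k : ℕ} (hk : k ≤ nQ a x) :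
    Skelφ.Prm.E₀ S + c' * k ≤ (schedOfT κ Φ t p D g f c S).rQ a x := by
  have h1 := Skelφ.Erad_linear (fun _ => 0) (Skelφ.Prm.E₀ S) hgap (nQ a x)
  have h2 : c' * k ≤ c' * nQ a x := Nat.mul_le_mul_left _ hk
  exact le_trans (by omega) (Erad_le_rQ_T κ Φ t p D g f c S a x)

end AnyBlock

/-! ## §2 At the block of record `SUS ex mx`: residual floors are floors on every radius -/

section AtSUS

variable (κ : Consts) {V : Type} [DecidableEq V] [Countable V] {G : SimpleGraph V} [G.LocallyFinite] (Φ : PlanarSkeletonFrmFrom G) (t : V)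
  (p : unitInterval) (D : Skelφ.StepI.DataNS V) (g f : ℕ) (c : Fin 2 → ℕ) (ex mx : GSlot) (q : unitInterval)

-- (cell-free, not re-declared: `ex_le_E₀_US` of SkelFrmBChoiceRadii)

/-- **`X ≤ ex → X ≤ rQ a x`** (e.g. `Pk.r₀ ≤ R` with `R := rQ α x`: a floor `r₀ ≤ ex`). [folklore] -/
theorem le_rQ_of_le_exT (κ : Consts) {V : Type} [DecidableEq V] [Countable V] {G : SimpleGraph V} [G.LocallyFinite] (Φ : PlanarSkeletonFrmFrom G) (t : V) (p : unitInterval) (D : Skelφ.StepI.DataNS V) (g : ℕ) (f : ℕ) (c : Fin 2 → ℕ) (ex : GSlot) (mx : GSlot) (q : unitInterval) {X : ℕ} (h : X ≤ ex κ Φ t p D g f) (a : ℕ) (x : Site 2) :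
    X ≤ (schedOfT κ Φ t p D g f c (SUS ex mx κ Φ t p D g f q)).rQ a x :=
  le_trans (le_trans h (ex_le_E₀_US κ Φ t p D g f ex mx q)) (E₀_le_rQ_T κ Φ t p D g f c _ a x)

/-- **`X ≤ ex → X ≤ rB a v δ`**. [folklore] -/
theorem le_rB_of_le_exT (κ : Consts) {V : Type} [DecidableEq V] [Countable V] {G : SimpleGraph V} [G.LocallyFinite] (Φ : PlanarSkeletonFrmFrom G) (t : V) (p : unitInterval) (D : Skelφ.StepI.DataNS V) (g : ℕ) (f : ℕ) (c : Fin 2 → ℕ) (ex : GSlot) (mx : GSlot) (q : unitInterval) {X : ℕ} (h : X ≤ ex κ Φ t p D g f) (a : ℕ) (v : Site 2) (δ : MDir) :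
    X ≤ (schedOfT κ Φ t p D g f c (SUS ex mx κ Φ t p D g f q)).rB a v δ :=
  le_trans (le_trans h (ex_le_E₀_US κ Φ t p D g f ex mx q)) (E₀_le_rB_T κ Φ t p D g f c _ a v δ)

/-- **`X + L′ ≤ ex → X ≤ rM a x`** (the arrival-box radius loses `L′`). [folklore] -/
theorem le_rM_of_le_exT (κ : Consts) {V : Type} [DecidableEq V] [Countable V] {G : SimpleGraph V} [G.LocallyFinite] (Φ : PlanarSkeletonFrmFrom G) (t : V) (p : unitInterval) (D : Skelφ.StepI.DataNS V) (g : ℕ) (f : ℕ) (c : Fin 2 → ℕ) (ex : GSlot) (mx : GSlot) (q : unitInterval) {X : ℕ} (h : X + Skelφ.Prm.Lp (SUS ex mx κ Φ t p D g f q) ≤ Skelφ.Prm.E₀ (SUS ex mx κ Φ t p D g f q)) (a : ℕ) (x : Site 2) :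
    X ≤ (schedOfT κ Φ t p D g f c (SUS ex mx κ Φ t p D g f q)).rM a x := by
  have := E₀_le_rM_T κ Φ t p D g f c (SUS ex mx κ Φ t p D g f q) a x
  omega

/-- **`cOffS·k + E₀ ≤ rQ a x`** for `k ≤ nQ a x` (the column constant is below every gap, `hgapc_US`). [folklore] -/
theorem lin_le_rQ_UT (κ : Consts) {V : Type} [DecidableEq V] [Countable V] {G : SimpleGraph V} [G.LocallyFinite] (Φ : PlanarSkeletonFrmFrom G) (t : V) (p : unitInterval) (D : Skelφ.StepI.DataNS V) (g : ℕ) (f : ℕ) (c : Fin 2 → ℕ) (ex : GSlot) (mx : GSlot) (q : unitInterval) (a : ℕ) (x : Site 2) {k : ℕ} (hk : k ≤ nQ a x) :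
    Skelφ.Prm.E₀ (SUS ex mx κ Φ t p D g f q) + cOffS κ Φ t p D g f * k ≤ (schedOfT κ Φ t p D g f c (SUS ex mx κ Φ t p D g f q)).rQ a x :=
  lin_le_rQ_T κ Φ t p D g f c _ (hgapc_US κ Φ t p D g f ex mx q) a x hk

/-- **THE DEPTH ROW (KGDepth's `hR`)**: at a cell `x` with `‖x‖₁ ≤ nQ a x` (run pairs), any budget `Z` with `Z + 1 ≤ ex` satisfies `(cOffS·‖x‖₁ + 1) + Z ≤ rQ a x` — the
column vertex's depth `D₀ = cOffS·‖x‖₁ + 1` (`colVT_mem_graphBall_lin`) plus the prism allowance `Z` (`:= (kq+3)·max ‖z‖₁` over p5's prism) fits in the cube radius.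
[cite: KozmaNitzan2024, §4 p. 31 (Step IV)] -/
theorem depth_row_UT (κ : Consts) {V : Type} [DecidableEq V] [Countable V] {G : SimpleGraph V} [G.LocallyFinite] (Φ : PlanarSkeletonFrmFrom G) (t : V) (p : unitInterval) (D : Skelφ.StepI.DataNS V) (g : ℕ) (f : ℕ) (c : Fin 2 → ℕ) (ex : GSlot) (mx : GSlot) (q : unitInterval) (a : ℕ) (x : Site 2) (hx : (x 0).natAbs + (x 1).natAbs ≤ nQ a x) {Z : ℕ} (hZ : Z + 1 ≤ ex κ Φ t p D g f) :
    (cOffS κ Φ t p D g f * ((x 0).natAbs + (x 1).natAbs) + 1) + Z ≤ (schedOfT κ Φ t p D g f c (SUS ex mx κ Φ t p D g f q)).rQ a x := by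
  have h1 := lin_le_rQ_UT κ Φ t p D g f c ex mx q a x hx
  have h2 := ex_le_E₀_US κ Φ t p D g f ex mx q
  omega

/-- **THE SUBTRACTED ROW (KGExcess's `R₁ ≤ R − L′`)**: `X + L′ + 1 ≤ E₀ → X ≤ rQ a x − L′`; with `X := Rex …` a floor on `ex` through `E₀_SUS_eq`. [folklore] -/
theorem sub_row_UT (κ : Consts) {V : Type} [DecidableEq V] [Countable V] {G : SimpleGraph V} [G.LocallyFinite] (Φ : PlanarSkeletonFrmFrom G) (t : V) (p : unitInterval) (D : Skelφ.StepI.DataNS V) (g : ℕ) (f : ℕ) (c : Fin 2 → ℕ) (ex : GSlot) (mx : GSlot) (q : unitInterval) {X : ℕ} (h : X + Skelφ.Prm.Lp (SUS ex mx κ Φ t p D g f q) + 1 ≤ Skelφ.Prm.E₀ (SUS ex mx κ Φ t p D g f q)) (a : ℕ) (x : Site 2) :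
    X ≤ (schedOfT κ Φ t p D g f c (SUS ex mx κ Φ t p D g f q)).rQ a x - Skelφ.Prm.Lp (SUS ex mx κ Φ t p D g f q) := by
  have := E₀_le_rQ_T κ Φ t p D g f c (SUS ex mx κ Φ t p D g f q) a x
  omega

end AtSUS

end NegB

end PlanarSkeletonFrmFrom

end Summit.CriticalPhenomena.PercolationContinuityZ3.Theorems.Transplant

end
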